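import Summits.AtomisticToContinuum.FouriersLaw.Theses.HonestZwanzig
import Summits.AtomisticToContinuum.FouriersLaw.Theses.JunctionLocality
import Summits.AtomisticToContinuum.FouriersLaw.Theorems.FourierGreenKuboFourierFiniteResponseOfUnique

/-!
# HonestZwanzig / PositiveMemory — the Green–Kubo floor from NOT-INSULATING (line `Sketch`, Stub K)

Support file for item `stmt-AtomisticToContinuum-12694` (`PositiveMemory` of route `HonestZwanzig`,
sub-problem `FouriersLaw`). The sibling crux `JunctionLocality.ConductanceLowerBound`
(item stmt-AtomisticToContinuum-11749: along every unique steady-state family the response coefficients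
satisfy `D_N ≥ c > 0` eventually in `N`) implies the GREEN–KUBO FLOOR
`∫₀^∞ corr_N(J,J) ≥ c·(N−1)T²` for all large `N ≥ 2`.

Proof: run the crux along the CANONICAL steady-state family (`pinnedChain_exists_isSteadyState`, junk `0`
at non-positive temperatures), which is unique (`JunctionLocality.NessUnique_holds`) and has response
coefficients `D_N` at every `N` (`FourierGreenKubo.finiteResponse_of_unique`); for `N ≥ 2` the landed
Kundu–Dhar–Narayan identity `HonestZwanzig.OpenChainGreenKubo`
(`OddSectorIrreversibility.Corrector.openChainGreenKubo_holds`) identifies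
`D_N = ∫₀^∞corr(J,J)/((N−1)T²)` by uniqueness of limits in `𝓝[≠] 0`, and `c ≤ D_N` clears the
(positive) denominator. This is the pattern of `floor_of_conductanceLowerBound` in
`…JunctionLocalityConductanceLowerBoundFloorEquivalence`.

* `greenKuboFloor_of_conductanceLowerBound`: the floor, with the Green–Kubo integral spelled out;
* `stub_greenKuboFloor`: the registered stub of line `Sketch` (verbatim signature).

No definitions, no named facts, no sorry.
-/

noncomputable section

open MeasureTheory Filter Topology
open Literature.MathematicalPhysics.KineticTheory.HeatConduction

namespace Summit.AtomisticToContinuum.FouriersLaw.Theorems.HonestZwanzig.PositiveMemory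

/-- **The Green–Kubo floor from `ConductanceLowerBound`.** If along every unique steady-state family the
response coefficients are eventually `≥ c > 0` (the sibling crux `JunctionLocality.ConductanceLowerBound`),
then for all parameters `> 0` and `T > 0` there are `c > 0` and `N₁` with
`c·((N−1)T²) ≤ ∫₀^∞ corr_N(J,J)` for every `N ≥ N₁`, `N ≥ 2`, where
`corr_N(J,J)(t) = ∫ J·(P_t J) dμ_T − (∫ J dμ_T)²` is the equilibrium autocorrelation of the total current
`J = Σ_i j_i` under the both-baths-at-`T` transition kernels. The response coefficient of the canonical
steady-state family is `D_N = ∫₀^∞corr_N(J,J)/((N−1)T²)` by the open-chain Green–Kubo identity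
(conductance `G = (1/T²)∫⟨j̄(t)j̄(0)⟩`, `j̄ = J/(N−1)`, `D_N = (N−1)G`). [cite: KunduDharNarayan2009, p. 3] -/
theorem greenKuboFloor_of_conductanceLowerBound
    (hCLB : Summit.AtomisticToContinuum.FouriersLaw.Theses.JunctionLocality.ConductanceLowerBound)
    {ω₂ lam β γ : ℝ} (hω : 0 < ω₂) (hl : 0 < lam) (hβ : 0 < β) (hγ : 0 < γ) {T : ℝ} (hT : 0 < T) :
    ∃ c : ℝ, 0 < c ∧ ∃ N₁ : ℕ, ∀ N : ℕ, N₁ ≤ N → 2 ≤ N →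
      c * (((N : ℝ) - 1) * T ^ 2) ≤ ∫ t in Set.Ioi (0 : ℝ),
        ((∫ z, (∑ i : Fin N, (pinnedChain ω₂ lam β γ).bondCurrent N i z) *
            (∫ y, (∑ i : Fin N, (pinnedChain ω₂ lam β γ).bondCurrent N i y)
              ∂((pinnedChain ω₂ lam β γ).transitionKernel N T T t.toNNReal z))
            ∂((pinnedChain ω₂ lam β γ).gibbsMeasure N T)) -
          (∫ z, (∑ i : Fin N, (pinnedChain ω₂ lam β γ).bondCurrent N i z)
            ∂((pinnedChain ω₂ lam β γ).gibbsMeasure N T)) *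
          (∫ z, (∑ i : Fin N, (pinnedChain ω₂ lam β γ).bondCurrent N i z)
            ∂((pinnedChain ω₂ lam β γ).gibbsMeasure N T))) := by
  -- adapted from `Cruxes.ConductanceLowerBound.ForecastSensitivity.floor_of_conductanceLowerBound`
  -- the canonical steady-state family
  let μ : (N : ℕ) → ℝ → ℝ → Measure (PhaseSpace N) := fun N a b =>
    if hab : 0 < a ∧ 0 < b then
      Classical.choose (pinnedChain_exists_isSteadyState hω hl hβ hγ N hab.1 hab.2)
    else 0
  have hμ : ∀ (N : ℕ) (T_L T_R : ℝ), 0 < T_L → 0 < T_R →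
      (pinnedChain ω₂ lam β γ).IsSteadyState N T_L T_R (μ N T_L T_R) := by
    intro N T_L T_R hL hR
    show (pinnedChain ω₂ lam β γ).IsSteadyState N T_L T_R
      (if hab : 0 < T_L ∧ 0 < T_R then
        Classical.choose (pinnedChain_exists_isSteadyState hω hl hβ hγ N hab.1 hab.2) else 0)
    rw [dif_pos ⟨hL, hR⟩]
    exact Classical.choose_spec (pinnedChain_exists_isSteadyState hω hl hβ hγ N hL hR)
  -- weak-NESS uniqueness
  have hU : ∀ (N : ℕ) (T_L T_R : ℝ), 0 < T_L → 0 < T_R → ∀ ρ ρ' : Measure (PhaseSpace N),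
      (pinnedChain ω₂ lam β γ).IsSteadyState N T_L T_R ρ →
      (pinnedChain ω₂ lam β γ).IsSteadyState N T_L T_R ρ' → ρ = ρ' :=
    Summit.AtomisticToContinuum.FouriersLaw.Theses.JunctionLocality.NessUnique_holds ω₂ lam β γ hω hl hβ hγ
  -- its response coefficients exist at every `N`
  have hDex := Summit.AtomisticToContinuum.FouriersLaw.Theorems.FourierGreenKubo.finiteResponse_of_unique
    ω₂ lam β γ hω hl hβ hγ hU μ hμ T hT
  choose D hD using hDex
  -- the crux: `c ≤ D N` eventually
  obtain ⟨c, hc, N₁, hcD⟩ := hCLB ω₂ lam β γ hω hl hβ hγ hU μ hμ T hT D hD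
  refine ⟨c, hc, N₁, fun N hN1 hN2 => ?_⟩
  -- the open-chain Green–Kubo identity identifies `D N`
  obtain ⟨-, hGK⟩ :=
    Summit.AtomisticToContinuum.FouriersLaw.Theorems.OddSectorIrreversibility.Corrector.openChainGreenKubo_holds
      ω₂ lam β γ hω hl hβ hγ hU μ hμ T hT N hN2
  have hDN := tendsto_nhds_unique (hD N) hGK
  have hcN : c ≤ D N := hcD N hN1
  rw [hDN] at hcN
  have hpos : (0 : ℝ) < ((N : ℝ) - 1) * T ^ 2 := by
    have h1 : (1 : ℝ) < (N : ℝ) := by exact_mod_cast (lt_of_lt_of_le one_lt_two hN2)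
    have : (0 : ℝ) < (N : ℝ) - 1 := sub_pos.mpr h1
    positivity
  exact (le_div_iff₀ hpos).mp hcN

/-- **Stub K of line `Sketch` — the Green–Kubo floor from NOT-INSULATING** (registered signature): the sibling
crux `JunctionLocality.ConductanceLowerBound` gives `∫₀^∞ corr(J,J) ≥ c·(N−1)T²` for all large `N ≥ 2`,
by `greenKuboFloor_of_conductanceLowerBound` (the `let`s unfold definitionally).
[cite: KunduDharNarayan2009, p. 3] -/
theorem stub_greenKuboFloor :
    Summit.AtomisticToContinuum.FouriersLaw.Theses.JunctionLocality.ConductanceLowerBound →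
    ∀ ω₂ lam β γ : ℝ, 0 < ω₂ → 0 < lam → 0 < β → 0 < γ → ∀ T : ℝ, 0 < T →
    ∃ c : ℝ, 0 < c ∧ ∃ N₁ : ℕ, ∀ N : ℕ, N₁ ≤ N → 2 ≤ N →
    let P := Literature.MathematicalPhysics.KineticTheory.HeatConduction.pinnedChain ω₂ lam β γ;
    let X := Literature.MathematicalPhysics.KineticTheory.HeatConduction.PhaseSpace N;
    let μ : MeasureTheory.Measure X := P.gibbsMeasure N T;
    let J : X → ℝ := fun z => ∑ i : Fin N, P.bondCurrent N i z;
    c * (((N : ℝ) - 1) * T ^ 2) ≤ ∫ t in Set.Ioi (0 : ℝ),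
      ((∫ z, J z * (∫ y, J y ∂(P.transitionKernel N T T t.toNNReal z)) ∂μ) - (∫ z, J z ∂μ) * (∫ z, J z ∂μ)) := by
  intro hCLB ω₂ lam β γ hω hl hβ hγ T hT
  exact greenKuboFloor_of_conductanceLowerBound hCLB hω hl hβ hγ hT

end Summit.AtomisticToContinuum.FouriersLaw.Theorems.HonestZwanzig.PositiveMemory

end
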